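import Literature.NumberTheory.LFunctions.TypicalOrdinatePointwise
import Literature.NumberTheory.LFunctions.TypicalOrdinateLevelSets
import Literature.NumberTheory.LFunctions.MertensBoundRH
import HarnessLib

/-!
# Pointwise bounds on the pieces of Soundararajan's contour (Balazard–de Roton 2008, §8.3)

Topic `Literature/NumberTheory/LFunctions`; a brick of the reduction of
`Literature.NumberTheory.LFunctions.BalazardDeRoton2010_thm1` to the engine statements of
Soundararajan's method. On the path `𝒮_N` of M. Balazard, A. de Roton, arXiv:0810.3587 §8.2
(= arXiv:0812.1689 §6.2) the integrand `f(z) = ζ(z)⁻¹ x^z/(z − iτ)` is estimated piece by piece in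
§8.3 (proof of Prop. 22): on the vertical unit segments and their connectors by Proposition 9
(`TypicalPointwise.norm_cpow_mul_inv_zeta_le`), on the first segment `Re z = ½ + 1/log x`,
`|Im z| ≤ N₀` by Propositions 1 and 18 with `V = log t/log log t` ("d'après la proposition 19"),
and on the last connector at height `T` by Proposition 1 (both cases). This file proves these
pointwise bounds in the shapes consumed by the staircase assembly (`SoundararajanContour.lean`):

* `SoundContour.integrand`, its holomorphy on `Re z > ½` under RH, and `norm_integrand_le`;
* the geometry `1 + |n − τ| ≤ 6‖z − iτ‖` on the strip `n ≤ Im z ≤ n+1`, `Re z ≥ ½` (and mirror);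
* `norm_vert_le` / `norm_conn_le` (Prop. 9 on a unit block and on a connector, in terms of
  `TypicalLevelSets.blockExp`);
* `norm_inv_zeta_mid_le` (first segment) and `norm_inv_zeta_end_le` (last connector).

## References

* [BalazardRoton2008] M. Balazard, A. de Roton, arXiv:0810.3587, §8.3 (proof of Prop. 22), Props.
  1, 9, 18, 19.
* [BalazardDeRoton2010] M. Balazard, A. de Roton, arXiv:0812.1689, §6.2 ("Troisième étape").
-/

noncomputable section

open Complex Real Set

namespace Literature.NumberTheory.LFunctions

namespace SoundContour

open Soundararajan TypicalLadder TypicalPointwise TypicalLevelSets MertensBoundRH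

/-! ### The integrand and its norm -/

/-- The integrand `f(z) = ζ(z)⁻¹ · x^z/(z − iτ)` of `B_N(iτ)` (with `ζ⁻¹` patched at `z = 1`).
[cite: BalazardDeRoton2010, §6.2] -/
def integrand (x τ : ℝ) (z : ℂ) : ℂ := zetaInv z * ((x : ℂ) ^ z / (z - τ * I))

/-- `Re(z − iτ) = Re z`. [folklore] -/
lemma re_sub_mul_I (z : ℂ) (τ : ℝ) : (z - τ * I).re = z.re := by simp

/-- `Im(z − iτ) = Im z − τ`. [folklore] -/
lemma im_sub_mul_I (z : ℂ) (τ : ℝ) : (z - τ * I).im = z.im - τ := by simp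

/-- `‖z − iτ‖ ≥ ½` when `Re z ≥ ½`. [folklore] -/
lemma half_le_norm_sub {z : ℂ} (hre : 1 / 2 ≤ z.re) (τ : ℝ) : 1 / 2 ≤ ‖z - τ * I‖ := by
  have h := Complex.abs_re_le_norm (z - τ * I)
  rw [re_sub_mul_I] at h
  exact le_trans (le_trans hre (le_abs_self _)) h

/-- `z − iτ ≠ 0` when `Re z ≥ ½`. [folklore] -/
lemma sub_mul_I_ne_zero {z : ℂ} (hre : 1 / 2 ≤ z.re) (τ : ℝ) : z - τ * I ≠ 0 := by
  intro h
  have := half_le_norm_sub hre τ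
  rw [h, norm_zero] at this
  linarith

/-- Under RH the integrand is holomorphic on `Re z > ½` (for `x > 0`). [folklore] -/
theorem differentiableOn_integrand (hRH : RiemannHypothesis) {x : ℝ} (hx : 0 < x) (τ : ℝ) :
    DifferentiableOn ℂ (integrand x τ) {z : ℂ | 1 / 2 < z.re} := by
  intro z hz
  have hz' : 1 / 2 < z.re := hz
  refine ((differentiableOn_zetaInv hRH z hz).mul ?_)
  refine DifferentiableWithinAt.div ?_ ?_ (sub_mul_I_ne_zero hz'.le τ)
  · exact ((differentiableAt_id.const_cpow (Or.inl (Complex.ofReal_ne_zero.2 hx.ne')))).differentiableWithinAt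
  · exact (differentiableAt_id.sub_const _).differentiableWithinAt

/-- **Geometry of the strip.** For `Re z ≥ ½` and `n ≤ Im z ≤ n + 1`: `1 + |n − τ| ≤ 6‖z − iτ‖`.
[cite: BalazardDeRoton2010, §6.2 ("`|z − iτ|⁻¹ ≪ (1+|n−τ|)⁻¹`")] -/
lemma one_add_abs_sub_le {z : ℂ} {n τ : ℝ} (hre : 1 / 2 ≤ z.re) (h1 : n ≤ z.im) (h2 : z.im ≤ n + 1) :
    1 + |n - τ| ≤ 6 * ‖z - τ * I‖ := by
  have hhalf := half_le_norm_sub hre τ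
  have hI : |z.im - τ| ≤ ‖z - τ * I‖ := by
    have h := Complex.abs_im_le_norm (z - τ * I)
    rwa [im_sub_mul_I] at h
  have htri : |n - τ| ≤ |z.im - τ| + 1 := by
    have := abs_sub_le n z.im τ
    have h3 : |n - z.im| ≤ 1 := by rw [abs_le]; constructor <;> linarith
    linarith
  rcases le_or_gt |n - τ| 2 with h | h
  · linarith
  · linarith

/-- Mirror image: for `Re z ≥ ½` and `n ≤ −Im z ≤ n + 1`: `1 + |n + τ| ≤ 6‖z − iτ‖`. [folklore] -/
lemma one_add_abs_add_le {z : ℂ} {n τ : ℝ} (hre : 1 / 2 ≤ z.re) (h1 : n ≤ -z.im)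
    (h2 : -z.im ≤ n + 1) : 1 + |n + τ| ≤ 6 * ‖z - τ * I‖ := by
  have hhalf := half_le_norm_sub hre τ
  have hI : |z.im - τ| ≤ ‖z - τ * I‖ := by
    have h := Complex.abs_im_le_norm (z - τ * I)
    rwa [im_sub_mul_I] at h
  have htri : |n + τ| ≤ |z.im - τ| + 1 := by
    have := abs_sub_le (-n) z.im τ
    have h3 : |-n - z.im| ≤ 1 := by rw [abs_le]; constructor <;> linarith
    have e : |n + τ| = |-n - τ| := by
      rw [show -n - τ = -(n + τ) by ring, abs_neg]
    linarith
  rcases le_or_gt |n + τ| 2 with h | h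
  · linarith
  · linarith

/-- **Norm of the integrand.** For `z ≠ 1` with `Re z ≥ ½`: if `‖x^z ζ(z)⁻¹‖ ≤ B` and
`1 ≤ W‖z − iτ‖` then `‖f(z)‖ ≤ B·W`. [folklore] -/
theorem norm_integrand_le {x τ : ℝ} {z : ℂ} (hz1 : z ≠ 1) (hre : 1 / 2 ≤ z.re)
    {B W : ℝ} (hB : ‖(x : ℂ) ^ z * (riemannZeta z)⁻¹‖ ≤ B) (hW : 1 ≤ W * ‖z - τ * I‖) :
    ‖integrand x τ z‖ ≤ B * W := by
  have hne := sub_mul_I_ne_zero hre τ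
  have hnpos : 0 < ‖z - τ * I‖ := norm_pos_iff.2 hne
  have hB0 : 0 ≤ B := le_trans (norm_nonneg _) hB
  rw [integrand, zetaInv_of_ne_one hz1, norm_mul, norm_div, ← mul_div_assoc, mul_comm ‖_‖,
    ← norm_mul, div_le_iff₀ hnpos]
  calc ‖(x : ℂ) ^ z * (riemannZeta z)⁻¹‖ ≤ B := hB
    _ = B * 1 := (mul_one B).symm
    _ ≤ B * (W * ‖z - τ * I‖) := mul_le_mul_of_nonneg_left hW hB0
    _ = B * W * ‖z - τ * I‖ := by ring

/-- `‖x^z ζ(z)⁻¹‖ ≤ x^{Re z} · Z` from `‖ζ(z)⁻¹‖ ≤ Z`. [folklore] -/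
lemma norm_cpow_mul_inv_le {x : ℝ} (hx : 0 < x) {z : ℂ} {Z : ℝ} (hZ : ‖(riemannZeta z)⁻¹‖ ≤ Z) :
    ‖(x : ℂ) ^ z * (riemannZeta z)⁻¹‖ ≤ x ^ z.re * Z := by
  rw [norm_mul, Complex.norm_cpow_eq_rpow_re_of_pos hx]
  exact mul_le_mul_of_nonneg_left hZ (Real.rpow_nonneg hx.le _)

/-! ### Elementary facts about block sizes -/

/-- For `T' ≥ e^{e²}`: `2 ≤ log log T'`, `e² ≤ log T'`, `0 < T'`, `1 < T'`. [folklore] -/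
lemma size_facts {T' : ℝ} (hTe : Real.exp (Real.exp 2) ≤ T') :
    2 ≤ Real.log (Real.log T') ∧ Real.exp 2 ≤ Real.log T' ∧ 0 < T' ∧ 1 < T' ∧
      7 < Real.log T' := by
  have hee : 0 < Real.exp (Real.exp 2) := Real.exp_pos _
  have hT0 : 0 < T' := hee.trans_le hTe
  have hLT : Real.exp 2 ≤ Real.log T' := by
    rw [← Real.log_exp (Real.exp 2)]; exact Real.log_le_log hee hTe
  have he2 : (7 : ℝ) < Real.exp 2 := by
    have h := Real.exp_one_gt_d9
    have : Real.exp 2 = Real.exp 1 * Real.exp 1 := by rw [← Real.exp_add]; norm_num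
    nlinarith
  have hL2 : 2 ≤ Real.log (Real.log T') := by
    rw [← Real.log_exp 2]; exact Real.log_le_log (Real.exp_pos 2) hLT
  have hT1 : 1 < T' := by
    by_contra h
    push Not at h
    have := Real.log_nonpos hT0.le h
    linarith
  exact ⟨hL2, hLT, hT0, hT1, by linarith⟩

/-- For an admissible `V` at size `T' ≥ e^{e²}`: `4 ≤ V`, `V ≤ log T'`, and
`exp V ≤ T'`. [folklore] -/
lemma admissible_sizes {δ T' : ℝ} {n V : ℕ} (hTe : Real.exp (Real.exp 2) ≤ T')
    (hadm : Admissible δ T' n V) :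
    4 ≤ (V : ℝ) ∧ (V : ℝ) ≤ Real.log T' / Real.log (Real.log T') ∧ (V : ℝ) ≤ Real.log T' := by
  obtain ⟨hL2, hLT, hT0, hT1, h7⟩ := size_facts hTe
  have hLT0 : 0 < Real.log T' := by linarith
  refine ⟨?_, hadm.2.1, ?_⟩
  · have : (2 : ℝ) ^ 2 ≤ Real.log (Real.log T') ^ 2 := pow_le_pow_left₀ (by norm_num) hL2 2
    linarith [hadm.1]
  · calc (V : ℝ) ≤ Real.log T' / Real.log (Real.log T') := hadm.2.1
      _ ≤ Real.log T' / 1 := div_le_div_of_nonneg_left hLT0.le one_pos (by linarith)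
      _ = Real.log T' := div_one _

/-! ### Proposition 9 on a unit block and on a connector -/

/-- `log(log x/log t) ≤ log(log x/log T')` for `1 < T' ≤ t ≤ x`. [folklore] -/
lemma log_ratio_mono {x T' t : ℝ} (hT1 : 1 < T') (hTt : T' ≤ t) (htx : t ≤ x) :
    Real.log (Real.log x / Real.log t) ≤ Real.log (Real.log x / Real.log T') := by
  have hlT : 0 < Real.log T' := Real.log_pos hT1
  have ht0 : 0 < t := by linarith
  have hlt : Real.log T' ≤ Real.log t := Real.log_le_log (by linarith) hTt
  have hlt0 : 0 < Real.log t := by linarith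
  have hlx : Real.log t ≤ Real.log x := Real.log_le_log ht0 htx
  have hlx0 : 0 < Real.log x := by linarith
  exact Real.log_le_log (div_pos hlx0 hlt0) (div_le_div_of_nonneg_left hlx0.le hlT hlt)

/-- **Prop. 9 on a vertical unit block** (Balazard–de Roton 2008, §8.3): if `V` is admissible for
`[n, n+1]` at size `T'` (`T₀ ≤ T'`, `e^{e²} ≤ T'`, `T' ≤ n`), `t ∈ [n, n+1]`, `t ≤ x`, and
`|Im z| = t`, `Re z = ½ + V/log x`, then
`‖x^z ζ(z)⁻¹‖ ≤ √x · exp(blockExp δ (max D 0 + 2) (log(log x/log T')) V)`.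
[cite: BalazardRoton2008, §8.3] -/
theorem norm_vert_le {δ D T₀ : ℝ} (hδ0 : 0 < δ) (hδ1 : δ ≤ 1) (hP1 : Prop1With δ D T₀)
    {T' x t : ℝ} {n V : ℕ} (hT₀ : T₀ ≤ T') (hTe : Real.exp (Real.exp 2) ≤ T')
    (hadm : Admissible δ T' n V) (hT'n : T' ≤ n) (ht1 : (n : ℝ) ≤ t) (ht2 : t ≤ n + 1) (htx : t ≤ x)
    {z : ℂ} (hz : |z.im| = t) (hzre : z.re = 1 / 2 + V / Real.log x) :
    ‖(x : ℂ) ^ z * (riemannZeta z)⁻¹‖ ≤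
      Real.sqrt x * Real.exp (blockExp δ (max D 0 + 2) (Real.log (Real.log x / Real.log T')) V) := by
  obtain ⟨hL2, hLT, hT0, hT1, h7⟩ := size_facts hTe
  obtain ⟨hV4, hVup, hVlog⟩ := admissible_sizes hTe hadm
  have ht0 : 1 < t := by linarith
  have hx1 : 1 < x := by linarith
  have hlx : 0 < Real.log x := Real.log_pos hx1
  have hzV : (z.re - 1 / 2) * Real.log x = V := by rw [hzre]; field_simp; ring
  have hre2 : z.re ≤ 2 := by
    rw [hzre]
    have : (V : ℝ) / Real.log x ≤ 1 := by
      rw [div_le_one hlx]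
      exact hVlog.trans (Real.log_le_log hT0 (by linarith))
    linarith
  have htyp : IsTypical δ T' V t := hadm.2.2 t ht1 ht2
  have h := norm_cpow_mul_inv_zeta_le hδ0 hδ1 hP1 hT₀ hTe hadm.1 hVup le_rfl htyp htx hz
    hzV.symm.le hzV.le hre2
  refine h.trans (mul_le_mul_of_nonneg_left (Real.exp_le_exp.2 ?_) (Real.sqrt_nonneg _))
  unfold blockExp
  have hmono := log_ratio_mono hT1 (hT'n.trans ht1) htx
  have := mul_le_mul_of_nonneg_left hmono (show (0 : ℝ) ≤ V by linarith)
  linarith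

/-- **Prop. 9 on a connector** (Balazard–de Roton 2008, §8.3, "car `n+1` est à la fois `V_n`-typique
et `V_{n+1}`-typique"): with `V` admissible for `[n, n+1]` at size `T'` and `W` admissible for
`[n+1, n+2]` at size `T''` (both sizes `≥ T₀, e^{e²}`, `T' ≤ n`, `T'' ≤ n+1`), `n + 1 ≤ x`,
`|Im z| = n+1` and `(Re z − ½) log x` between `V` and `W`:
`‖x^z ζ(z)⁻¹‖ ≤ √x · (exp(blockExp … (log(log x/log T')) V) + exp(blockExp … (log(log x/log T'')) W))`.
[cite: BalazardRoton2008, §8.3] -/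
theorem norm_conn_le {δ D T₀ : ℝ} (hδ0 : 0 < δ) (hδ1 : δ ≤ 1) (hP1 : Prop1With δ D T₀)
    {T' T'' x : ℝ} {n V W : ℕ} (hT₀ : T₀ ≤ T') (hTe : Real.exp (Real.exp 2) ≤ T')
    (hT₀' : T₀ ≤ T'') (hTe' : Real.exp (Real.exp 2) ≤ T'')
    (hadm : Admissible δ T' n V) (hadm' : Admissible δ T'' (n + 1) W) (hT'n : T' ≤ n)
    (hT''n : T'' ≤ n + 1) (hnx : (n : ℝ) + 1 ≤ x) {z : ℂ} (hz : |z.im| = n + 1)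
    (hz1 : min (V : ℝ) W ≤ (z.re - 1 / 2) * Real.log x) (hz2 : (z.re - 1 / 2) * Real.log x ≤ max (V : ℝ) W) :
    ‖(x : ℂ) ^ z * (riemannZeta z)⁻¹‖ ≤
      Real.sqrt x * (Real.exp (blockExp δ (max D 0 + 2) (Real.log (Real.log x / Real.log T')) V) +
        Real.exp (blockExp δ (max D 0 + 2) (Real.log (Real.log x / Real.log T'')) W)) := by
  obtain ⟨hL2, hLT, hT0, hT1, h7⟩ := size_facts hTe
  obtain ⟨hL2', hLT', hT0', hT1', h7'⟩ := size_facts hTe'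
  obtain ⟨hV4, hVup, hVlog⟩ := admissible_sizes hTe hadm
  obtain ⟨hW4, hWup, hWlog⟩ := admissible_sizes hTe' hadm'
  have hx1 : 1 < x := by linarith
  have hlx : 0 < Real.log x := Real.log_pos hx1
  have hn1x : Real.log ((n : ℝ) + 1) ≤ Real.log x := Real.log_le_log (by linarith) hnx
  have hre2 : z.re ≤ 2 := by
    have hm : max (V : ℝ) W ≤ Real.log x := by
      refine max_le (hVlog.trans (Real.log_le_log hT0 ?_)) (hWlog.trans (Real.log_le_log hT0' ?_))
      · linarith
      · linarith
    have : (z.re - 1 / 2) * Real.log x ≤ 1 * Real.log x := by linarith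
    have := le_of_mul_le_mul_right this hlx
    linarith
  have htypV : IsTypical δ T' V (n + 1) := hadm.2.2 _ (by linarith) le_rfl
  have htypW : IsTypical δ T'' W (n + 1) := by
    have := hadm'.2.2 ((n : ℝ) + 1) (by push_cast; linarith) (by push_cast; linarith)
    simpa using this
  have hsx : 0 ≤ Real.sqrt x := Real.sqrt_nonneg x
  have hexpV : 0 ≤ Real.exp (blockExp δ (max D 0 + 2) (Real.log (Real.log x / Real.log T')) V) :=
    (Real.exp_pos _).le
  have hexpW : 0 ≤ Real.exp (blockExp δ (max D 0 + 2) (Real.log (Real.log x / Real.log T'')) W) :=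
    (Real.exp_pos _).le
  rcases le_total (V : ℝ) W with hVW | hWV
  · -- `V ≤ W`: typical for `V` at size `T'`, bound in terms of `W`
    rw [min_eq_left hVW] at hz1
    rw [max_eq_right hVW] at hz2
    have h := norm_cpow_mul_inv_zeta_le hδ0 hδ1 hP1 hT₀ hTe hadm.1 hVup hVW htypV hnx hz hz1 hz2 hre2
    refine h.trans ?_
    have key : (W : ℝ) * Real.log (Real.log x / Real.log ((n : ℝ) + 1)) +
        2 * (1 + δ) * W * Real.log (Real.log W) + (max D 0 + 2) * W * δ⁻¹ ^ 2 ≤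
        blockExp δ (max D 0 + 2) (Real.log (Real.log x / Real.log T'')) W := by
      unfold blockExp
      have hmono := log_ratio_mono hT1' hT''n hnx
      have := mul_le_mul_of_nonneg_left hmono (show (0 : ℝ) ≤ W by linarith)
      linarith
    have h2 := mul_le_mul_of_nonneg_left (Real.exp_le_exp.2 key) hsx
    linarith [mul_nonneg hsx hexpV]
  · -- `W ≤ V`: typical for `W` at size `T''`, bound in terms of `V`
    rw [min_eq_right hWV] at hz1
    rw [max_eq_left hWV] at hz2
    have h := norm_cpow_mul_inv_zeta_le hδ0 hδ1 hP1 hT₀' hTe' hadm'.1 hWup hWV htypW hnx hz hz1 hz2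
      hre2
    refine h.trans ?_
    have key : (V : ℝ) * Real.log (Real.log x / Real.log ((n : ℝ) + 1)) +
        2 * (1 + δ) * V * Real.log (Real.log V) + (max D 0 + 2) * V * δ⁻¹ ^ 2 ≤
        blockExp δ (max D 0 + 2) (Real.log (Real.log x / Real.log T')) V := by
      unfold blockExp
      have hmono := log_ratio_mono hT1 (hT'n.trans (by linarith)) hnx
      have := mul_le_mul_of_nonneg_left hmono (show (0 : ℝ) ≤ V by linarith)
      linarith
    have h2 := mul_le_mul_of_nonneg_left (Real.exp_le_exp.2 key) hsx
    linarith [mul_nonneg hsx hexpW]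

/-! ### The first segment: Propositions 1 and 18 with `V = log t/log log t` -/

/-- `‖ζ(σ + it)⁻¹‖ = exp(−log‖ζ(σ+it)‖)` under RH for `σ > ½`. [folklore] -/
lemma norm_inv_zeta_eq_exp (hRH : RiemannHypothesis) {σ t : ℝ} (hσ : 1 / 2 < σ) :
    ‖(riemannZeta (σ + t * I))⁻¹‖ = Real.exp (-Real.log ‖riemannZeta (σ + t * I)‖) := by
  have hne : riemannZeta (σ + t * I) ≠ 0 :=
    InvZetaRH.riemannZeta_ne_zero_of_RH hRH (by simpa using hσ)
  rw [norm_inv, Real.exp_neg, Real.exp_log (norm_pos_iff.2 hne)]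

/-- **The first segment** (Balazard–de Roton 2008, §8.3 via Props. 1, 18 — their Prop. 19):
for `t'` large (`T₁, T₁₈ ≤ t'`, `4 ≤ log log t'`, `2 log log log t' ≤ log log t'`,
`(log log t')³ ≤ log t'`), `L ≥ 1` and `1/L ≤ σ − ½ ≤ 1/log log t'`:
`‖ζ(σ ± it')⁻¹‖ ≤ exp((log t'/log log t')(log L + 2(1+δ) log log log t' + Dδ⁻²))`.
[cite: BalazardRoton2008, Prop. 19 and §8.3] -/
theorem norm_inv_zeta_mid_le (hRH : RiemannHypothesis) {δ D T₁ T₁₈ : ℝ} (hδ0 : 0 < δ)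
    (hP1 : Prop1With δ D T₁) (h18 : Prop18With δ T₁₈) {t' σ L : ℝ} (hT₁ : T₁ ≤ t')
    (hT₁₈ : T₁₈ ≤ t') (hL₂ : 4 ≤ Real.log (Real.log t'))
    (hL₃ : 2 * Real.log (Real.log (Real.log t')) ≤ Real.log (Real.log t'))
    (hcube : Real.log (Real.log t') ^ 3 ≤ Real.log t') (hL1 : 1 ≤ L) (hσ1 : 1 / L ≤ σ - 1 / 2)
    (hσ2 : σ - 1 / 2 ≤ 1 / Real.log (Real.log t')) {u : ℝ} (hu : |u| = t') :
    ‖(riemannZeta (σ + u * I))⁻¹‖ ≤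
      Real.exp (Real.log t' / Real.log (Real.log t') *
        (Real.log L + 2 * (1 + δ) * Real.log (Real.log (Real.log t')) + D * δ⁻¹ ^ 2)) := by
  have hℓ₂0 : 0 < Real.log (Real.log t') := by linarith
  have hℓ64 : 64 ≤ Real.log t' := by
    have : (4 : ℝ) ^ 3 ≤ Real.log (Real.log t') ^ 3 := pow_le_pow_left₀ (by norm_num) hL₂ 3
    linarith
  have hℓ0 : 0 < Real.log t' := by linarith
  have hℓne : Real.log t' ≠ 0 := hℓ0.ne'
  have hℓ₂ne : Real.log (Real.log t') ≠ 0 := hℓ₂0.ne'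
  have ht'0 : 0 < t' := by
    rcases lt_or_ge 0 t' with h0 | h0
    · exact h0
    · have : t' = 0 := le_antisymm h0 (hu ▸ abs_nonneg u)
      rw [this, Real.log_zero] at hℓ0
      exact absurd hℓ0 (lt_irrefl 0)
  have hL0 : 0 < L := by linarith
  have hσhalf : 1 / 2 < σ := by
    have : 0 < 1 / L := by positivity
    linarith
  -- `V = log t'/log log t'` is in the admissible range and `t'` is `V`-typical of size `t'`
  have hVlo : Real.log (Real.log t') ^ 2 ≤ Real.log t' / Real.log (Real.log t') := by
    rw [le_div_iff₀ hℓ₂0]; nlinarith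
  have hV16 : 16 ≤ Real.log t' / Real.log (Real.log t') := le_trans (by nlinarith) hVlo
  have hVℓ : Real.log t' / Real.log (Real.log t') ≤ Real.log t' := by
    rw [div_le_iff₀ hℓ₂0]; nlinarith
  have e1 : Real.log t' / Real.log (Real.log t') * Real.log (Real.log t') / Real.log t' = 1 := by
    field_simp
  have htyp : IsTypical δ t' (Real.log t' / Real.log (Real.log t')) t' := by
    refine h18 t' hT₁₈ _ ?_ ?_ t' le_rfl (by linarith)
    · rw [e1]
      have : Real.log (Real.log (Real.log t')) / Real.log (Real.log t') ≤ 1 / 2 := by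
        rw [div_le_iff₀ hℓ₂0]; linarith
      linarith
    · rw [e1]
  -- Prop. 1, case 1, at `σ`
  have e2 : Real.log t' / Real.log (Real.log t') / Real.log t' = 1 / Real.log (Real.log t') := by
    field_simp
  have hσV : σ ≤ 1 / 2 + Real.log t' / Real.log (Real.log t') / Real.log t' := by
    rw [e2]; linarith
  have h1 := (hP1 t' hT₁ _ hVlo le_rfl t' htyp σ).1 hσhalf hσV
  rw [e2] at h1
  -- simplify the lower bound
  have hσ0 : 0 < σ - 1 / 2 := by linarith
  have hratio : Real.log (1 / Real.log (Real.log t') / (σ - 1 / 2)) ≤ Real.log L := by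
    refine Real.log_le_log (by positivity) ?_
    rw [div_le_iff₀ hσ0]
    have h1L : 1 / Real.log (Real.log t') ≤ 1 := by rw [div_le_one hℓ₂0]; linarith
    have h2 : 1 ≤ L * (σ - 1 / 2) := by
      rw [div_le_iff₀' hL0] at hσ1; linarith
    nlinarith
  have hllV : Real.log (Real.log (Real.log t' / Real.log (Real.log t'))) ≤
      Real.log (Real.log (Real.log t')) := by
    have hlogV : Real.log (Real.log t' / Real.log (Real.log t')) ≤ Real.log (Real.log t') :=
      Real.log_le_log (by linarith) hVℓ
    exact Real.log_le_log (Real.log_pos (by linarith)) hlogV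
  have hV0 : 0 ≤ Real.log t' / Real.log (Real.log t') := by linarith
  have hlow : -(Real.log t' / Real.log (Real.log t') *
      (Real.log L + 2 * (1 + δ) * Real.log (Real.log (Real.log t')) + D * δ⁻¹ ^ 2)) ≤
      Real.log ‖riemannZeta (σ + t' * I)‖ := by
    have a1 := mul_le_mul_of_nonneg_left hratio hV0
    have a2 : 2 * (1 + δ) * (Real.log t' / Real.log (Real.log t')) *
        Real.log (Real.log (Real.log t' / Real.log (Real.log t'))) ≤
        2 * (1 + δ) * (Real.log t' / Real.log (Real.log t')) * Real.log (Real.log (Real.log t')) :=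
      mul_le_mul_of_nonneg_left hllV (by positivity)
    linarith
  -- conclude for `u = ±t'`
  have hnorm : ‖(riemannZeta (σ + u * I))⁻¹‖ = ‖(riemannZeta (σ + t' * I))⁻¹‖ := by
    rcases (abs_eq ht'0.le).1 hu with h | h
    · rw [h]
    · rw [h, norm_inv, norm_inv]
      have := norm_riemannZeta_ofReal_add_neg σ t'
      rw [show ((-t' : ℝ) : ℂ) = -(t' : ℂ) by push_cast; ring] at this
      rw [show ((-t' : ℝ) : ℂ) * I = -(t' : ℂ) * I by push_cast; ring]
      rw [this]
  rw [hnorm, norm_inv_zeta_eq_exp hRH hσhalf]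
  exact Real.exp_le_exp.2 (by linarith)

/-! ### The last connector: Proposition 1, both cases -/

/-- **The last connector** (Balazard–de Roton 2008, §8.3, last display): with `V` admissible for
`[n, n+1]` at size `T'` (`T₀ ≤ T'`, `e^{e²} ≤ T'`), `t ∈ [n, n+1]`, `log T' ≤ L`, and
`V/L ≤ σ − ½`, `σ ≤ 2`:
`‖ζ(σ ± it)⁻¹‖ ≤ exp(blockExp δ D₂ (log(L/log T')) V) + exp(D V δ⁻¹)` (`D₂ = max D 0 + 2`).
[cite: BalazardRoton2008, §8.3] -/
theorem norm_inv_zeta_end_le (hRH : RiemannHypothesis) {δ D T₀ : ℝ} (hδ0 : 0 < δ) (hδ1 : δ ≤ 1)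
    (hP1 : Prop1With δ D T₀) {T' L t : ℝ} {n V : ℕ} (hT₀ : T₀ ≤ T')
    (hTe : Real.exp (Real.exp 2) ≤ T') (hadm : Admissible δ T' n V) (ht1 : (n : ℝ) ≤ t)
    (ht2 : t ≤ n + 1) (hL : Real.log T' ≤ L) {σ : ℝ} (hσ1 : (V : ℝ) / L ≤ σ - 1 / 2) (hσ2 : σ ≤ 2)
    {u : ℝ} (hu : |u| = t) :
    ‖(riemannZeta (σ + u * I))⁻¹‖ ≤
      Real.exp (blockExp δ (max D 0 + 2) (Real.log (L / Real.log T')) V) +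
        Real.exp (D * V * δ⁻¹) := by
  obtain ⟨hL2, hLT, hT0, hT1, h7⟩ := size_facts hTe
  obtain ⟨hV4, hVup, hVlog⟩ := admissible_sizes hTe hadm
  have hLT0 : 0 < Real.log T' := by linarith
  have hL0 : 0 < L := by linarith
  have hV0 : (0 : ℝ) < V := by linarith
  have hσhalf : 1 / 2 < σ := by
    have : 0 < (V : ℝ) / L := by positivity
    linarith
  have ht0 : 0 ≤ t := le_trans (Nat.cast_nonneg n) ht1
  have htyp : IsTypical δ T' V t := hadm.2.2 t ht1 ht2
  obtain ⟨hc1, hc2⟩ := hP1 T' hT₀ V hadm.1 hVup t htyp σ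
  have hllV0 : 0 ≤ Real.log (Real.log V) := by
    apply Real.log_nonneg
    rw [Real.le_log_iff_exp_le hV0]
    have := Real.exp_one_lt_d9; linarith
  have hδi1 : 1 ≤ δ⁻¹ := (one_le_inv₀ hδ0).2 hδ1
  have hδ2 : δ⁻¹ ≤ δ⁻¹ ^ 2 := le_self_pow₀ hδi1 (by norm_num)
  -- reduce to `u = t`
  have hnorm : ‖(riemannZeta (σ + u * I))⁻¹‖ = ‖(riemannZeta (σ + t * I))⁻¹‖ := by
    rcases (abs_eq ht0).1 hu with h | h
    · rw [h]
    · rw [h, norm_inv, norm_inv]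
      have := norm_riemannZeta_ofReal_add_neg σ t
      rw [show ((-t : ℝ) : ℂ) * I = -(t : ℂ) * I by push_cast; ring]
      rw [show ((-t : ℝ) : ℂ) = -(t : ℂ) by push_cast; ring] at this
      rw [this]
  rw [hnorm, norm_inv_zeta_eq_exp hRH hσhalf]
  have hpos1 : 0 < Real.exp (blockExp δ (max D 0 + 2) (Real.log (L / Real.log T')) V) :=
    Real.exp_pos _
  have hpos2 : 0 < Real.exp (D * V * δ⁻¹) := Real.exp_pos _
  rcases le_or_gt σ (1 / 2 + V / Real.log T') with hcase | hcase
  · -- case 1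
    have h := hc1 hσhalf hcase
    have hσ0 : 0 < σ - 1 / 2 := by linarith
    have hratio : Real.log (V / Real.log T' / (σ - 1 / 2)) ≤ Real.log (L / Real.log T') := by
      refine Real.log_le_log (by positivity) ?_
      rw [div_le_div_iff₀ hσ0 hLT0]
      rw [div_le_iff₀ hL0] at hσ1
      calc (V : ℝ) / Real.log T' * Real.log T' = V := div_mul_cancel₀ _ hLT0.ne'
        _ ≤ (σ - 1 / 2) * L := hσ1
        _ = L * (σ - 1 / 2) := by ring
    have a1 := mul_le_mul_of_nonneg_left hratio hV0.le
    have hDle : D * V * δ⁻¹ ^ 2 ≤ (max D 0 + 2) * V * δ⁻¹ ^ 2 := by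
      have : D ≤ max D 0 + 2 := by linarith [le_max_left D 0]
      have h0 : 0 ≤ (V : ℝ) * δ⁻¹ ^ 2 := by positivity
      nlinarith
    refine le_trans ?_ (le_add_of_nonneg_right hpos2.le)
    refine Real.exp_le_exp.2 ?_
    unfold blockExp
    linarith
  · -- case 2
    have h := hc2 hcase.le hσ2
    refine le_trans ?_ (le_add_of_nonneg_left hpos1.le)
    exact Real.exp_le_exp.2 (by linarith)

end SoundContour

end Literature.NumberTheory.LFunctions

end
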